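import Summits.QuantumFields.YangMills.Theorems.BalabanUVNodesN18KingModelScalesPair
import Summits.QuantumFields.YangMills.Theorems.BalabanUVNodesN18KingModelTorusMassUniform
import Literature.MathematicalPhysics.QuantumFieldTheory.King1986.MinimizerHolderRateUniform

/-!
# BalabanUVNodes ∕ N18 — King's (3.75), FIRST LINE (the Hölder quotient `∂_α(x, y)` on an external line), `j ≥ 1`, FOR
# KING'S ACTUAL OPERATORS ON BAŁABAN'S TORI — THE MASS-UNIFORM EDITION: `κ, C₅` functions of `(d, L, a, m₀², γ, α)` ONLY,
# EVERY domain reading ITS OWN mass in `(0, m₀²]`, in particular King's PHYSICAL slice masses `m²(L^jη)²` of (2.20) (Track A,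
# DAG node N18 = NE5 `T4OutputRate.NE5 EA EB W κ θ C₅` :211; cluster K4; row s3 «King-model transfer `N18KingModelTorus` (κ, C₅
# from (d, L, a, m², γ))»; module 14 of seat pub-ymgap-dag-n18-e (g26), `--supports stmt-QuantumFields-20544 --as helper` = K3⁷
# `SpineGivenEndpointR13SepCoPH`)

HONEST FRAMING.  Count-neutral kernel bookkeeping.  King's A = 0 scalar MODEL of the NE5 mechanism on finite tori (template
literature, published and proved) — NOT Bałaban's covariant one-step outputs `E^{(j)}(X; g, U)`, for which NE5 is NOT IN PRINT and
has no tree producer; NOT a node discharge; nothing continuum ∕ ℝ⁴ ∕ OS ∕ mass-gap ∕ Clay.  THEOREMS ONLY: 0 `def`, 0 `sorry`,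
standard axioms.

THE POINT.  `N18KingModelTorusHolder.ne5_kingModel_threeFactorHolder_torus` (p-TorusHolder of the -a∕-b loop) delivers King's
(3.75), first line, as a multi-scale `NE5` inhabitant with `κ > 0`, `C₅ ≥ 0` «functions of `d, L, a, m², γ, α` only», reading the
pair-anchored three-factor graphs with ONE lattice-unit mass `m²` at EVERY scale `j`.  By King's rescaling (2.20) p. 654 the
slice `G^ε_{(j)}` of (2.17) carries, in scale-`j` lattice units, the mass `m²(L^jη)²` — a DIFFERENT number at every scale, all in
`(0, m²]` — so that reading is unphysical across scales and its constants were not stated uniformly in the mass (the defect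
`N18KingModelTorusMassUniform` (module 12) removed for (3.73)'s first bound and `N18KingModelTorusDerivMassUniform` (module 13)
for its second).  The Hölder row's inputs are now mass-uniform in the tree: seat n15-e's `MinimizerHolderDecayUniform`
(`holder_kernel_decay_blocks_unif`, p543533) and this seat's `MinimizerHolderRateUniform` (`king_prop38_holder_torus_blocks_unif`
— the sup rate `king_prop38_holder_torus` was mass-free from the start).  THIS FILE is the Hölder line's twin of module 12:
* §1 `ne5_of_threeFactorRates_lemma45_pair_massProfile` — `N18KingModelScalesPair.ne5_of_threeFactorRates_lemma45_pair` re-run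
  with a MASS PROFILE `mass : C.Dom → ℝ`, `0 < mass X` (its middle letters `γ₀, κ′, K₄₅, δ₄₅` never depended on the mass).
* §2 **`ne5_kingModel_threeFactorHolder_torus_unif`** — `κ > 0`, `C₅ ≥ 0` functions of `(d, L, a, m₀², γ, α)` ONLY, such that
  p-TorusHolder's conclusion `NE5 EA EB W κ (L^{−γ∕2}) C₅` holds for EVERY MASS PROFILE `0 < mass X ≤ m₀²` read by both runs at `X`.
* §3 **`ne5_kingModel_threeFactorHolder_torus_physMass`** — §2 at King's PHYSICAL profile `mass X = m²·(L^{scale X}·eps L k)²`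
  (`= m²(L^jη)²`) for a run of `k ≥ scale X` steps; ONE `(κ, C₅)` for all `k`.
HONEST SCOPE.  (i) `A = 0`, periodic b.c., odd `L ≥ 3`, `m² > 0`, flat blocks; (ii) lattice units of scale `j` (the factor
`(L^jη)^{2−d−α−γ}` of (3.75) is NOT inserted); (iii) «one lattice mass at all scales» — GONE; (iv) `j ≥ 1`; (v) `|x − y|` = the
sup torus distance in unit coordinates (`holdist`); (vi) the SECOND line of (3.75) (`∂^η_μ` inside the quotient, `α + γ < 1`) is
the sibling `N18KingModelTorusHolderDerivMassUniform`; (3.74) (contour operator `G(Γ, b)`) is not a scalar-template object; (vii)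
not Bałaban's `E^{(j)}(X; g, U)`; not a discharge.  Inputs BY NAME: `holder_kernel_decay_blocks_unif` (n15-e),
`king_prop38_holder_torus_blocks_unif` (this seat, Literature), `minimiser_row_decay_unif`, `minimiser_row_rate_unif`, `physMass_pos`,
`physMass_le_cap` (module 12), `ne5_of_threeFactorRates_pair`, `fprop38Const_le_unif`, `sqrt_rate_le_unif`,
`aliasConst_nonneg_of_lt_one` (`N18KingModelScalesPair`), `king_cov_decay_torus`, `king_lemma45_torus`, `outerRate_le_unif`,
`blockOf_over`, `tdistT_symm`, `tdistT_sumBound`, `exp_decay_mono`.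

Sources: C. King, Commun. Math. Phys. **102** (1986) 649–677 [King1986] — (2.17) p. 653, (2.20) p. 654, Thm 3.3 (3.6)–(3.8)
pp. 655–656, (3.62) p. 663, Prop. 3.7 (3.64)–(3.65) p. 663, Prop. 3.8 (3.71) p. 664 (lines 1 and 3), Prop. 3.9 (3.75) p. 665,
Lemma 4.5 (4.38) p. 674, (4.42)–(4.43) p. 675; T. Bałaban, Commun. Math. Phys. **89** (1983) 571–597 [Balaban1983RegularityDecay]
Thm (1.9)–(1.10) p. 573 («constants … depending on d, M only, c₀ on α also» — the mass-uniform root); T. Bałaban, Commun. Math.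
Phys. **109** (1987) 249–301 [Balaban1987RG1] (0.24)–(0.25) p. 257 (the only printed trace of NE5).  No claim about the mass gap.
-/

noncomputable section

namespace Summit.QuantumFields.YangMills.BalabanUVNodes.N18KingModelTorusHolderMassUniform

open Real Matrix
open Literature.MathematicalPhysics.QuantumFieldTheory.Balaban1983to89 (Params)
open Literature.MathematicalPhysics.QuantumFieldTheory.Balaban1983to89.T4OutputRate (Carriers Functional NE5)
open Literature.MathematicalPhysics.QuantumFieldTheory.Balaban1983to89.B5Prop11Plancherel (Tor fine)
open Literature.MathematicalPhysics.QuantumFieldTheory.Balaban1983to89.B4Sect5Proof (latticeConst latticeConst_nonneg)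
open Literature.MathematicalPhysics.QuantumFieldTheory.King1986
  (aK lemma43Const prop38RateConst prop38PosConst fprop38RateConst fprop38PosConst exp_decay_mono)
open Literature.MathematicalPhysics.QuantumFieldTheory.King1986.ContinuumLimit (eps)
open Literature.MathematicalPhysics.QuantumFieldTheory.King1986.Torus
  (minimiser effLaplacian blockProj blockOf blockOf_over tdistT tdistT_symm tdistT_nonneg tdistT_isPseudoDist tdistT_sumBound
    holdist K45 K45_nonneg delta45 delta45_pos gam0L gam0L_pos kapCT aminL_le_aK king_lemma45_torus
    holder_kernel_decay_blocks_unif king_prop38_holder_torus_blocks_unif)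
open Summit.QuantumFields.YangMills.BalabanUVNodes.N18KingModel (kingTheta_pos coarse_val)
open Summit.QuantumFields.YangMills.BalabanUVNodes.N18KingModelScales
  (king_cov_decay_torus inv_pow_le_kingTheta_pow delta45_le_kapCT)
open Summit.QuantumFields.YangMills.BalabanUVNodes.N18KingModelTorus (outerRate_le_unif)
open Summit.QuantumFields.YangMills.BalabanUVNodes.N18KingModelScalesPair
  (ne5_of_threeFactorRates_pair fprop38Const_le_unif sqrt_rate_le_unif aliasConst_nonneg_of_lt_one)
open Summit.QuantumFields.YangMills.BalabanUVNodes.N18KingModelTorusMassUniform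
  (minimiser_row_decay_unif minimiser_row_rate_unif physMass_pos physMass_le_cap)

variable {d : ℕ}

/-! ## §1 (3.75)'s assembly on the torus with a MASS PROFILE: the middle line's letters are mass-free -/

/-- **`N18KingModelScalesPair.ne5_of_threeFactorRates_lemma45_pair` WITH A MASS PROFILE.**  King's actual middle factors
`C^{(j)} = (Δ^{(j)} + aL⁻²Q*Q)⁻¹`, `C^{(j+n)}` on the scale-`j` torus (`j = scale X ≥ 1`, `L ≥ 2`, `a > 0`, `n ≥ 1`, `γ ≤ 1`),
read at the domain's OWN mass `mass X > 0`; run A's output at `X` = `u_A(X) ⬝ (C^{(j)} v_A(X))`, run B's = `u_B(X) ⬝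
(C^{(j+n)} v_B(X))`, the ROWS anchored at the PAIR `p₁ X, p₂ X` (size `sA`, rate `cA·(L^{−γ})^j`, decay from the nearer anchor),
the columns at `r X` (size `sB`, rate `cB·(L^{−γ})^j`), common decay `0 < κ ≤ δ₄₅`, tree length `≤ min(|p₁ X − r X|, |p₂ X − r X|)`.
BY NAME per domain: middle size ∕ decay `king_cov_decay_torus` (size `2∕γ₀`, `κ′ ≥ δ₄₅ ≥ κ`), middle rate `king_lemma45_torus`
(`K₄₅L^{−j}e^{−δ₄₅·tdist}`, `L^{−j} ≤ (L^{−γ})^j`), lattice sums `tdistT_sumBound` — the letters `γ₀, κ′, K₄₅, δ₄₅` are functions of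
`(d, a, L)` only, so the conclusion `NE5 EA EB W (κ∕2) (L^{−γ}) (2(cA·(2∕γ₀)·sB + sA·K₄₅·sB + sA·(2∕γ₀)·cB)·K_d(κ∕2)²)` is uniform in
the profile.  A = 0 MODEL, periodic b.c.
[cite: King1986, Prop. 3.9 (3.75) p.665, (4.42)–(4.43) p.675, (4.33)–(4.34) and Lemma 4.5 (4.38) p.674] -/
theorem ne5_of_threeFactorRates_lemma45_pair_massProfile {C : Carriers} {EA : Functional C C.BgA} {EB : Functional C C.BgB}
    {W : Set (ℕ → ℝ)} (L : ℕ) [NeZero L] (hL : 2 ≤ L) {a : ℝ} (ha : 0 < a)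
    (mass : C.Dom → ℝ) (hmass : ∀ X, 0 < mass X)
    {n : ℕ} (hn : 1 ≤ n) (M : ℕ → Fin d → ℕ) [∀ j μ, NeZero (M j μ)] {γ : ℝ} (hγ1 : γ ≤ 1)
    (hsc : ∀ X : C.Dom, 1 ≤ C.scale X)
    (p₁ p₂ r : (X : C.Dom) → Tor (fine L (M (C.scale X))))
    (uA uB vA vB : (X : C.Dom) → Tor (fine L (M (C.scale X))) → ℝ)
    (CA CB : (X : C.Dom) → Matrix (Tor (fine L (M (C.scale X)))) (Tor (fine L (M (C.scale X)))) ℝ)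
    (hCAdef : ∀ X, CA X = (effLaplacian (L ^ C.scale X) (fine L (M (C.scale X))) (aK a L (C.scale X))
          (((L ^ C.scale X : ℕ) : ℝ) ^ 2) (mass X) + (a * ((L : ℝ) ^ 2)⁻¹) • blockProj L (M (C.scale X)))⁻¹)
    (hCBdef : ∀ X, CB X = (effLaplacian (L ^ n * L ^ C.scale X) (fine L (M (C.scale X))) (aK a L (C.scale X + n))
          (((L ^ n * L ^ C.scale X : ℕ) : ℝ) ^ 2) (mass X) + (a * ((L : ℝ) ^ 2)⁻¹) • blockProj L (M (C.scale X)))⁻¹)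
    {κ sA sB cA cB : ℝ} (hκ : 0 < κ) (hκδ : κ ≤ delta45 d a L) (hsA : 0 ≤ sA) (hsB : 0 ≤ sB)
    (hcA : 0 ≤ cA) (hcB : 0 ≤ cB)
    (hu : ∀ X z, |uA X z| ≤ sA * Real.exp (-(κ * min (tdistT _ (p₁ X) z) (tdistT _ (p₂ X) z))))
    (hv : ∀ X w, |vB X w| ≤ sB * Real.exp (-(κ * tdistT _ w (r X))))
    (hdu : ∀ X z, |uB X z - uA X z|
      ≤ cA * ((L : ℝ) ^ (-γ)) ^ C.scale X * Real.exp (-(κ * min (tdistT _ (p₁ X) z) (tdistT _ (p₂ X) z))))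
    (hdv : ∀ X w, |vB X w - vA X w| ≤ cB * ((L : ℝ) ^ (-γ)) ^ C.scale X * Real.exp (-(κ * tdistT _ w (r X))))
    (hd : ∀ X, C.d X ≤ min (tdistT _ (p₁ X) (r X)) (tdistT _ (p₂ X) (r X)))
    (hEA : ∀ g U X, EA g U X = uA X ⬝ᵥ (CA X *ᵥ vA X))
    (hEB : ∀ g U X, EB g U X = uB X ⬝ᵥ (CB X *ᵥ vB X)) :
    NE5 EA EB W (κ / 2) ((L : ℝ) ^ (-γ))
      (2 * ((cA * (2 / gam0L d a L) * sB + sA * K45 d a L * sB + sA * (2 / gam0L d a L) * cB)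
        * (latticeConst d (κ / 2)) ^ 2)) := by
  have hL1 : 1 ≤ L := by omega
  have hθ : 0 ≤ (L : ℝ) ^ (-γ) := (kingTheta_pos hL1 γ).le
  have hγ₀ : 0 < gam0L d a L := gam0L_pos ha hL
  have hsC : 0 ≤ 2 / gam0L d a L := by positivity
  have hκ' : κ ≤ kapCT d a L := hκδ.trans (delta45_le_kapCT ha hL)
  -- the middle factors' undifferenced decay BY NAME (`king_cov_decay_torus` at the domain's mass), weakened from `κ′` to `κ`
  have hCA : ∀ X z w, |CA X z w| ≤ 2 / gam0L d a L * Real.exp (-(κ * tdistT _ z w)) := by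
    intro X z w
    obtain ⟨hlo, hhi⟩ := aminL_le_aK ha hL (hsc X)
    rw [hCAdef]
    exact (king_cov_decay_torus ha (hmass X) hL (L ^ C.scale X) hlo hhi (M (C.scale X)) z w).trans
      (exp_decay_mono hsC hκ' ((tdistT_isPseudoDist _).nonneg z w))
  have hCB : ∀ X z w, |CB X z w| ≤ 2 / gam0L d a L * Real.exp (-(κ * tdistT _ z w)) := by
    intro X z w
    obtain ⟨hlo, hhi⟩ := aminL_le_aK ha hL (show 1 ≤ C.scale X + n by have := hsc X; omega)
    rw [hCBdef]
    exact (king_cov_decay_torus ha (hmass X) hL (L ^ n * L ^ C.scale X) hlo hhi (M (C.scale X)) z w).trans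
      (exp_decay_mono hsC hκ' ((tdistT_isPseudoDist _).nonneg z w))
  -- the middle line's RATE: Lemma 4.5 BY NAME at the domain's mass, `L^{-j} ≤ θ^j`, decay weakened from `δ₄₅` to `κ`
  have hdC : ∀ X z w, |CB X z w - CA X z w|
      ≤ K45 d a L * ((L : ℝ) ^ (-γ)) ^ C.scale X * Real.exp (-(κ * tdistT _ z w)) := by
    intro X z w
    have h45 := king_lemma45_torus ha (hmass X) hL (hsc X) hn (M (C.scale X)) z w
    rw [hCAdef, hCBdef, abs_sub_comm]
    refine h45.trans ?_
    have hK : 0 ≤ K45 d a L := K45_nonneg a L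
    have ht : 0 ≤ tdistT _ z w := (tdistT_isPseudoDist _).nonneg z w
    calc K45 d a L * ((L : ℝ) ^ C.scale X)⁻¹ * Real.exp (-(delta45 d a L * tdistT _ z w))
        ≤ K45 d a L * ((L : ℝ) ^ (-γ)) ^ C.scale X * Real.exp (-(delta45 d a L * tdistT _ z w)) :=
          mul_le_mul_of_nonneg_right (mul_le_mul_of_nonneg_left (inv_pow_le_kingTheta_pow hL1 hγ1 _) hK)
            (Real.exp_pos _).le
      _ ≤ K45 d a L * ((L : ℝ) ^ (-γ)) ^ C.scale X * Real.exp (-(κ * tdistT _ z w)) :=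
          exp_decay_mono (mul_nonneg hK (pow_nonneg hθ _)) hκδ ht
  -- the lattice sums BY NAME (uniform in the torus)
  have hV : ∀ (j : ℕ) (s : Tor (fine L (M j))),
      ∑ z, Real.exp (-(κ / 2 * tdistT (fine L (M j)) s (id z))) ≤ latticeConst d (κ / 2) :=
    fun j s => tdistT_sumBound (fine L (M j)) (κ / 2) (half_pos hκ) s
  exact ne5_of_threeFactorRates_pair (β := fun j => Tor (fine L (M j))) (P := fun j => Tor (fine L (M j)))
    (fun j => tdistT (fine L (M j))) (fun j => (tdistT_isPseudoDist _).nonneg)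
    (fun j => (tdistT_isPseudoDist _).triangle) (fun _ => id) p₁ p₂ r uA uB vA vB CA CB hκ.le hθ hsA hsC hsB hcA
    (K45_nonneg a L) hcB hu hCA hCB hv hdu hdC hdv hV hd hEA hEB

/-! ## §2 (3.75), first line, `j ≥ 1`, on Bałaban's tori — `κ, C₅` from `(d, L, a, m₀², γ, α)`, every domain its own mass -/

/-- **KING'S (3.75), FIRST LINE (THE HÖLDER QUOTIENT `∂_α(x, y)` ON THE LEFT EXTERNAL LINE), `j ≥ 1`, MASS-UNIFORM — the Hölder
row's theorem of record with the mass quantified INSIDE.**  For `d ≥ 1`, odd `L > 1`, `a > 0`, a cap `m₀² > 0`, `0 < α`, `0 < γ`,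
`α + γ ≤ 1` there are `κ > 0`, `C₅ ≥ 0` — functions of `d, L, a, m₀², γ, α` ONLY — such that: for every `n ≥ 1`; every
scale-indexed family of unit tori `L·M_j(μ) = 2L^{m_j}`; every carriers `C` with `1 ≤ scale X` whose domain `X` of scale `j` reads
THREE fine points `x_A(X)`, `y_A(X)` (the Hölder pair), `z_A(X)` of `T_η` UNDER `x_B(X)`, `y_B(X)`, `z_B(X) ∈ T_{η′}` with tree
length at most `dist({B(x_A), B(y_A)}, B(z_A))` on `T₁`; EVERY MASS PROFILE `mass : C.Dom → ℝ`, `0 < mass X ≤ m₀²`; every two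
functionals reading the (4.42) graphs with the HÖLDER row — run A `Σ_{u,w} |x_A − y_A|^{−α}(ℋ_j(x_A, u) − ℋ_j(y_A, u))·C^{(j)}(u, w)·
ℋ_j(z_A, w)` (`|x − y|` = `holdist`), run B the same at `j + n` with primes — with King's ACTUAL `A = 0` operators AT THE MASS
`mass X`; every window: `NE5 EA EB W κ (L^{−γ∕2}) C₅` — ONE `θ` for all scales, ONE `(κ, C₅)` for all masses under the cap.
Composition: §1 at `γ∕2` with `hu` ≔ `holder_kernel_decay_blocks_unif`, `hdu` ≔ `king_prop38_holder_torus_blocks_unif` ∘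
`fprop38Const_le_unif` ∘ `sqrt_rate_le_unif`, `hv` ≔ `minimiser_row_decay_unif` (∘ `blockOf_over`, `tdistT_symm`), `hdv` ≔
`minimiser_row_rate_unif` ∘ `outerRate_le_unif` (∘ `tdistT_symm`), `κ = min(δ^{H}, δ₀^{dec}, δ^{H,rate}∕2, δ₀^{rate}∕2, δ₄₅)`.
`N18KingModelTorusHolder.ne5_kingModel_threeFactorHolder_torus` = the constant profile `mass X = m²`, cap `m²`.  A = 0 MODEL.
[cite: King1986, (2.20) p.654, Prop. 3.9 (3.75) p.665, (3.62) p.663, (4.42)–(4.43) p.675, Prop. 3.8 (3.71) p.664, Lemma 4.5 (4.38)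
p.674, Theorem 3.3 (3.8) p.658; Balaban1983RegularityDecay, Theorem (1.10) p.573] -/
theorem ne5_kingModel_threeFactorHolder_torus_unif (hd : 1 ≤ d) (L : ℕ) [NeZero L] (hLp : Odd L ∧ 1 < L) {a : ℝ}
    (ha : 0 < a) {m0sq : ℝ} (hm0 : 0 < m0sq) {α γ : ℝ} (hα : 0 < α) (hγ : 0 < γ) (hαγ : α + γ ≤ 1) :
    ∃ κ C₅ : ℝ, 0 < κ ∧ 0 ≤ C₅ ∧
      ∀ (n : ℕ) (_hn : 1 ≤ n) (M : ℕ → Fin d → ℕ) [∀ j μ, NeZero (M j μ)]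
        (_hM : ∀ j, ∃ mm : ℕ, ∀ μ, L * M j μ = 2 * L ^ mm)
        (C : Carriers) (_hsc : ∀ X, 1 ≤ C.scale X)
        (xA yA zA : (X : C.Dom) → Tor (fine (L ^ C.scale X) (fine L (M (C.scale X)))))
        (xB yB zB : (X : C.Dom) → Tor (fine (L ^ n * L ^ C.scale X) (fine L (M (C.scale X)))))
        (_hx : ∀ X μ, (xA X μ).val = (xB X μ).val / L ^ n)
        (_hy : ∀ X μ, (yA X μ).val = (yB X μ).val / L ^ n)
        (_hz : ∀ X μ, (zA X μ).val = (zB X μ).val / L ^ n)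
        (_hd : ∀ X, C.d X ≤ min
            (tdistT (fine L (M (C.scale X))) (blockOf (L ^ C.scale X) (fine L (M (C.scale X))) (xA X))
              (blockOf (L ^ C.scale X) (fine L (M (C.scale X))) (zA X)))
            (tdistT (fine L (M (C.scale X))) (blockOf (L ^ C.scale X) (fine L (M (C.scale X))) (yA X))
              (blockOf (L ^ C.scale X) (fine L (M (C.scale X))) (zA X))))
        (mass : C.Dom → ℝ) (_hmass : ∀ X, 0 < mass X) (_hcap : ∀ X, mass X ≤ m0sq)
        (EA : Functional C C.BgA) (EB : Functional C C.BgB)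
        (_hEA : ∀ g U X, EA g U X =
          (fun u => (holdist (L ^ C.scale X) (fine L (M (C.scale X))) (xA X) (yA X)) ^ (-α)
              * (minimiser (L ^ C.scale X) (fine L (M (C.scale X))) (aK a L (C.scale X))
                    (((L ^ C.scale X : ℕ) : ℝ) ^ 2) (mass X) (Pi.single u 1) (xA X)
                  - minimiser (L ^ C.scale X) (fine L (M (C.scale X))) (aK a L (C.scale X))
                    (((L ^ C.scale X : ℕ) : ℝ) ^ 2) (mass X) (Pi.single u 1) (yA X)))
            ⬝ᵥ ((effLaplacian (L ^ C.scale X) (fine L (M (C.scale X))) (aK a L (C.scale X))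
                    (((L ^ C.scale X : ℕ) : ℝ) ^ 2) (mass X)
                  + (a * ((L : ℝ) ^ 2)⁻¹) • blockProj L (M (C.scale X)))⁻¹
                *ᵥ fun w => minimiser (L ^ C.scale X) (fine L (M (C.scale X))) (aK a L (C.scale X))
                    (((L ^ C.scale X : ℕ) : ℝ) ^ 2) (mass X) (Pi.single w 1) (zA X)))
        (_hEB : ∀ g U X, EB g U X =
          (fun u => (holdist (L ^ n * L ^ C.scale X) (fine L (M (C.scale X))) (xB X) (yB X)) ^ (-α)
              * (minimiser (L ^ n * L ^ C.scale X) (fine L (M (C.scale X))) (aK a L (C.scale X + n))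
                    (((L ^ n * L ^ C.scale X : ℕ) : ℝ) ^ 2) (mass X) (Pi.single u 1) (xB X)
                  - minimiser (L ^ n * L ^ C.scale X) (fine L (M (C.scale X))) (aK a L (C.scale X + n))
                    (((L ^ n * L ^ C.scale X : ℕ) : ℝ) ^ 2) (mass X) (Pi.single u 1) (yB X)))
            ⬝ᵥ ((effLaplacian (L ^ n * L ^ C.scale X) (fine L (M (C.scale X))) (aK a L (C.scale X + n))
                    (((L ^ n * L ^ C.scale X : ℕ) : ℝ) ^ 2) (mass X)
                  + (a * ((L : ℝ) ^ 2)⁻¹) • blockProj L (M (C.scale X)))⁻¹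
                *ᵥ fun w => minimiser (L ^ n * L ^ C.scale X) (fine L (M (C.scale X))) (aK a L (C.scale X + n))
                    (((L ^ n * L ^ C.scale X : ℕ) : ℝ) ^ 2) (mass X) (Pi.single w 1) (zB X)))
        (W : Set (ℕ → ℝ)),
        NE5 EA EB W κ ((L : ℝ) ^ (-(γ / 2))) C₅ := by
  have hd0 : 0 < d := hd
  have hL2 : 2 ≤ L := by have := hLp.2; omega
  have hα1 : α < 1 := by linarith
  have hγ1 : γ ≤ 1 := by linarith
  -- the outer-line packages, MASS INSIDE, BY NAME: the Hölder row (n15-e's `_unif` decay, this seat's `_unif` rate), the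
  -- column (module 12 §1: rows and columns from ONE decay package)
  obtain ⟨δ₁, c₁, hδ₁, hc₁, H₁⟩ := holder_kernel_decay_blocks_unif d L hd hLp.1 hL2 ha hm0.le hα hα1
  obtain ⟨δ₂, c₂, hδ₂, hc₂, H₂⟩ := minimiser_row_decay_unif d L hd hLp ha hm0.le
  obtain ⟨δ₃, c₃, hδ₃, hc₃, H₃⟩ := king_prop38_holder_torus_blocks_unif d L hd hLp.1 hL2 ha hm0.le hα hγ hαγ
  obtain ⟨δ₄, c₄, hδ₄, hc₄, H₄⟩ := minimiser_row_rate_unif d L hd hLp.1 hL2 ha hm0.le hγ.le hγ1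
  -- one common decay rate
  have hδ45 : 0 < delta45 d a L := delta45_pos (d := d) ha hL2
  set κ : ℝ := min (min (min δ₁ δ₂) (min (δ₃ / 2) (δ₄ / 2))) (delta45 d a L) with hκ_def
  have hκpos : 0 < κ :=
    lt_min (lt_min (lt_min hδ₁ hδ₂) (lt_min (half_pos hδ₃) (half_pos hδ₄))) hδ45
  have hκ₁ : κ ≤ δ₁ := (min_le_left _ _).trans ((min_le_left _ _).trans (min_le_left _ _))
  have hκ₂ : κ ≤ δ₂ := (min_le_left _ _).trans ((min_le_left _ _).trans (min_le_right _ _))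
  have hκ₃ : κ ≤ δ₃ / 2 := (min_le_left _ _).trans ((min_le_right _ _).trans (min_le_left _ _))
  have hκ₄ : κ ≤ δ₄ / 2 := (min_le_left _ _).trans ((min_le_right _ _).trans (min_le_right _ _))
  have hκ45 : κ ≤ delta45 d a L := min_le_right _ _
  -- the uniform letters
  set Cu : ℝ := prop38RateConst a a (a * (2 * ((a * (1 - ((L : ℝ) ^ 2)⁻¹))⁻¹ + π ^ 2 / 48 + 1 / 3)))
      ((π ^ 2 / 4) ^ d) d γ + prop38PosConst a ((π ^ 2 / 4) ^ d) d γ with hCu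
  set CuH : ℝ := fprop38RateConst a a (a * (2 * ((a * (1 - ((L : ℝ) ^ 2)⁻¹))⁻¹ + π ^ 2 / 48 + 1 / 3)))
      ((π ^ 2 / 4) ^ d) d γ α (2 * (d : ℝ) ^ α) 0
      + fprop38PosConst a ((π ^ 2 / 4) ^ d) d γ α (2 * (d : ℝ) ^ α) (6 * (d : ℝ) ^ (α + γ)) with hCuH
  set cA : ℝ := Real.sqrt (2 * c₃ * CuH) with hcA
  set cB : ℝ := Real.sqrt (2 * (a * c₄) * Cu) with hcB
  have hcA0 : 0 ≤ cA := Real.sqrt_nonneg _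
  have hcB0 : 0 ≤ cB := Real.sqrt_nonneg _
  have hsB : 0 ≤ a * c₂ := by positivity
  have hγ₀ : 0 < gam0L d a L := gam0L_pos ha hL2
  have hK45 : 0 ≤ K45 d a L := K45_nonneg a L
  have hKd : 0 ≤ latticeConst d (κ / 2) := latticeConst_nonneg d (half_pos hκpos).le
  have hAC : 0 ≤ Literature.MathematicalPhysics.QuantumFieldTheory.King1986.aliasConst d (α + γ - 1) :=
    aliasConst_nonneg_of_lt_one hd0 (by linarith)
  refine ⟨κ / 2, 2 * ((cA * (2 / gam0L d a L) * (a * c₂) + c₁ * K45 d a L * (a * c₂)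
      + c₁ * (2 / gam0L d a L) * cB) * (latticeConst d (κ / 2)) ^ 2), half_pos hκpos, by positivity, ?_⟩
  intro n hn M _ hM C hsc xA yA zA xB yB zB hx hy hz hdd mass hmass hcap EA EB hEA hEB W
  have hγ2 : γ / 2 ≤ 1 := by linarith
  -- every scale-`j` torus of the family is the unit torus of the Bałaban volume `(d, L, m_j, K)` for any `K`
  have hvol : ∀ (j K : ℕ), ∃ mm : ℕ, ∀ μ, fine L (M j) μ = (⟨d, L, mm, K, hd, hLp⟩ : Params).sitesPerDir K := fun j K => by
    obtain ⟨mm, hmm⟩ := hM j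
    exact ⟨mm, fun μ => by simp only [Params.sitesPerDir, Nat.add_sub_cancel]; exact hmm μ⟩
  refine ne5_of_threeFactorRates_lemma45_pair_massProfile (C := C) (EA := EA) (EB := EB) (W := W) L hL2 ha mass hmass hn M
    hγ2 hsc
    (fun X => blockOf (L ^ C.scale X) (fine L (M (C.scale X))) (xA X))
    (fun X => blockOf (L ^ C.scale X) (fine L (M (C.scale X))) (yA X))
    (fun X => blockOf (L ^ C.scale X) (fine L (M (C.scale X))) (zA X))
    (fun X u => (holdist (L ^ C.scale X) (fine L (M (C.scale X))) (xA X) (yA X)) ^ (-α)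
      * (minimiser (L ^ C.scale X) (fine L (M (C.scale X))) (aK a L (C.scale X))
            (((L ^ C.scale X : ℕ) : ℝ) ^ 2) (mass X) (Pi.single u 1) (xA X)
          - minimiser (L ^ C.scale X) (fine L (M (C.scale X))) (aK a L (C.scale X))
            (((L ^ C.scale X : ℕ) : ℝ) ^ 2) (mass X) (Pi.single u 1) (yA X)))
    (fun X u => (holdist (L ^ n * L ^ C.scale X) (fine L (M (C.scale X))) (xB X) (yB X)) ^ (-α)
      * (minimiser (L ^ n * L ^ C.scale X) (fine L (M (C.scale X))) (aK a L (C.scale X + n))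
            (((L ^ n * L ^ C.scale X : ℕ) : ℝ) ^ 2) (mass X) (Pi.single u 1) (xB X)
          - minimiser (L ^ n * L ^ C.scale X) (fine L (M (C.scale X))) (aK a L (C.scale X + n))
            (((L ^ n * L ^ C.scale X : ℕ) : ℝ) ^ 2) (mass X) (Pi.single u 1) (yB X)))
    (fun X w => minimiser (L ^ C.scale X) (fine L (M (C.scale X))) (aK a L (C.scale X))
      (((L ^ C.scale X : ℕ) : ℝ) ^ 2) (mass X) (Pi.single w 1) (zA X))
    (fun X w => minimiser (L ^ n * L ^ C.scale X) (fine L (M (C.scale X))) (aK a L (C.scale X + n))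
      (((L ^ n * L ^ C.scale X : ℕ) : ℝ) ^ 2) (mass X) (Pi.single w 1) (zB X))
    (fun X => (effLaplacian (L ^ C.scale X) (fine L (M (C.scale X))) (aK a L (C.scale X))
        (((L ^ C.scale X : ℕ) : ℝ) ^ 2) (mass X) + (a * ((L : ℝ) ^ 2)⁻¹) • blockProj L (M (C.scale X)))⁻¹)
    (fun X => (effLaplacian (L ^ n * L ^ C.scale X) (fine L (M (C.scale X))) (aK a L (C.scale X + n))
        (((L ^ n * L ^ C.scale X : ℕ) : ℝ) ^ 2) (mass X) + (a * ((L : ℝ) ^ 2)⁻¹) • blockProj L (M (C.scale X)))⁻¹)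
    (fun _ => rfl) (fun _ => rfl) hκpos hκ45 hc₁.le hsB hcA0 hcB0 ?_ ?_ ?_ ?_ hdd hEA hEB
  · -- `hu`: run A's HÖLDER row at the mass `mass X` (`holder_kernel_decay_blocks_unif`, volume `(d, L, m_j, j)`), pair-anchored
    intro X u
    obtain ⟨mm, hMK⟩ := hvol (C.scale X) (C.scale X)
    have h := H₁ ⟨d, L, mm, C.scale X, hd, hLp⟩ rfl rfl (hsc X) (mass X) (hmass X) (hcap X) (fine L (M (C.scale X))) hMK
      (L ^ C.scale X) rfl (xA X) (yA X) u
    exact h.trans (exp_decay_mono hc₁.le hκ₁ (le_min (tdistT_nonneg _ _ _) (tdistT_nonneg _ _ _)))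
  · -- `hv`: run B's column at the mass `mass X` (volume `(d, L, m_j, j + n)`), block under `z_B` = `B(z_A)`, `tdistT` symmetric
    intro X w
    obtain ⟨mm, hMK⟩ := hvol (C.scale X) (C.scale X + n)
    have hN : L ^ n * L ^ C.scale X = L ^ (C.scale X + n) := by rw [pow_add, mul_comm]
    have h := H₂ ⟨d, L, mm, C.scale X + n, hd, hLp⟩ rfl rfl (show 1 ≤ C.scale X + n by have := hsc X; omega)
      (mass X) (hmass X).le (hcap X) (fine L (M (C.scale X))) hMK (L ^ n * L ^ C.scale X) hN κ hκpos hκ₂ (zB X) w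
    rw [blockOf_over (fine L (M (C.scale X))) (zA X) (zB X) (hz X), tdistT_symm] at h
    exact h
  · -- `hdu`: the HÖLDER row difference at the mass `mass X`, (3.71) line 3 in its printed shape
    -- (`king_prop38_holder_torus_blocks_unif`), its constant made `K, n`-free (`fprop38Const_le_unif`, `sqrt_rate_le_unif`),
    -- decay weakened from `δ₃∕2` to `κ`
    intro X u
    obtain ⟨mm, hMK⟩ := hvol (C.scale X) (C.scale X)
    haveI : NeZero (⟨d, L, mm, C.scale X, hd, hLp⟩ : Params).L := ‹NeZero L›
    have h := H₃ ⟨d, L, mm, C.scale X, hd, hLp⟩ rfl rfl (hsc X) (mass X) (hmass X) (hcap X) n hn (fine L (M (C.scale X)))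
      hMK (xA X) (yA X) (xB X) (yB X) u (hx X) (hy X)
    have hmin : 0 ≤ min (tdistT (fine L (M (C.scale X))) (blockOf (L ^ C.scale X) (fine L (M (C.scale X))) (xA X)) u)
        (tdistT (fine L (M (C.scale X))) (blockOf (L ^ C.scale X) (fine L (M (C.scale X))) (yA X)) u) :=
      le_min (tdistT_nonneg _ _ _) (tdistT_nonneg _ _ _)
    refine (h.trans (exp_decay_mono (Real.sqrt_nonneg _) hκ₃ hmin)).trans ?_
    refine mul_le_mul_of_nonneg_right ?_ (Real.exp_pos _).le
    exact sqrt_rate_le_unif (fprop38Const_le_unif ha hL2 (hsc X) hn (by positivity) (by positivity) hAC)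
      (by positivity) L (C.scale X) γ
  · -- `hdv`: the column difference at the mass `mass X`, (3.71) line 1 (`minimiser_row_rate_unif`) by symmetry of the torus
    -- distance, `outerRate_le_unif`
    intro X w
    obtain ⟨mm, hMK⟩ := hvol (C.scale X) (C.scale X)
    haveI : NeZero (⟨d, L, mm, C.scale X, hd, hLp⟩ : Params).L := ‹NeZero L›
    have h := H₄ ⟨d, L, mm, C.scale X, hd, hLp⟩ rfl rfl (hsc X) (mass X) (hmass X) (hcap X) n hn (fine L (M (C.scale X)))
      hMK κ hκpos hκ₄ (zA X) (zB X) w (hz X)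
    rw [tdistT_symm (fine L (M (C.scale X))) w]
    exact h.trans (mul_le_mul_of_nonneg_right (outerRate_le_unif hd0 ha hL2 (hsc X) hn hγ1 hc₄.le)
      (Real.exp_pos _).le)

/-! ## §3 King's PHYSICAL profile `m²(L^jη)²` of (2.20): one `(κ, C₅)` for all the slices of a run -/

/-- **KING'S (3.75), FIRST LINE, `j ≥ 1`, AT THE PHYSICAL MASSES OF (2.20).**  For `d ≥ 1`, odd `L > 1`, `a > 0`, a physical mass
`m² > 0`, `0 < α`, `0 < γ`, `α + γ ≤ 1` there are `κ > 0`, `C₅ ≥ 0` (functions of `d, L, a, m², γ, α`) such that for EVERY run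
length `k`, every `n ≥ 1`, volumes, carriers with `1 ≤ scale X ≤ k`, the three fine points ∕ tree lengths of §2, and functionals
reading the pair-anchored (4.42) graphs of run A (slice `j = scale X` of `G^η_k`, `η = L^{−k} = eps L k`) and run B (slice `j + n`
of `G^{η′}_{k+n}`) AT THE PHYSICAL LATTICE MASS `m²·(L^j·η)²` (the same number for both runs, `L^jη = L^{j+n}η′`):
`NE5 EA EB W κ (L^{−γ∕2}) C₅`.  §2 at the profile `mass X = m²·(L^{scale X}·eps L k)²` (`physMass_pos`, `physMass_le_cap`).
A = 0 MODEL; lattice units of scale `j`. [cite: King1986, (2.17) p.653, (2.20) p.654, Prop. 3.9 (3.75) p.665, (4.42)–(4.43) p.675] -/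
theorem ne5_kingModel_threeFactorHolder_torus_physMass (hd : 1 ≤ d) (L : ℕ) [NeZero L] (hLp : Odd L ∧ 1 < L) {a m2 : ℝ}
    (ha : 0 < a) (hm : 0 < m2) {α γ : ℝ} (hα : 0 < α) (hγ : 0 < γ) (hαγ : α + γ ≤ 1) :
    ∃ κ C₅ : ℝ, 0 < κ ∧ 0 ≤ C₅ ∧
      ∀ (k n : ℕ) (_hn : 1 ≤ n) (M : ℕ → Fin d → ℕ) [∀ j μ, NeZero (M j μ)]
        (_hM : ∀ j, ∃ mm : ℕ, ∀ μ, L * M j μ = 2 * L ^ mm)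
        (C : Carriers) (_hsc : ∀ X, 1 ≤ C.scale X) (_hsk : ∀ X, C.scale X ≤ k)
        (xA yA zA : (X : C.Dom) → Tor (fine (L ^ C.scale X) (fine L (M (C.scale X)))))
        (xB yB zB : (X : C.Dom) → Tor (fine (L ^ n * L ^ C.scale X) (fine L (M (C.scale X)))))
        (_hx : ∀ X μ, (xA X μ).val = (xB X μ).val / L ^ n)
        (_hy : ∀ X μ, (yA X μ).val = (yB X μ).val / L ^ n)
        (_hz : ∀ X μ, (zA X μ).val = (zB X μ).val / L ^ n)
        (_hd : ∀ X, C.d X ≤ min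
            (tdistT (fine L (M (C.scale X))) (blockOf (L ^ C.scale X) (fine L (M (C.scale X))) (xA X))
              (blockOf (L ^ C.scale X) (fine L (M (C.scale X))) (zA X)))
            (tdistT (fine L (M (C.scale X))) (blockOf (L ^ C.scale X) (fine L (M (C.scale X))) (yA X))
              (blockOf (L ^ C.scale X) (fine L (M (C.scale X))) (zA X))))
        (EA : Functional C C.BgA) (EB : Functional C C.BgB)
        (_hEA : ∀ g U X, EA g U X =
          (fun u => (holdist (L ^ C.scale X) (fine L (M (C.scale X))) (xA X) (yA X)) ^ (-α)
              * (minimiser (L ^ C.scale X) (fine L (M (C.scale X))) (aK a L (C.scale X))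
                    (((L ^ C.scale X : ℕ) : ℝ) ^ 2) (m2 * ((L : ℝ) ^ C.scale X * eps L k) ^ 2) (Pi.single u 1) (xA X)
                  - minimiser (L ^ C.scale X) (fine L (M (C.scale X))) (aK a L (C.scale X))
                    (((L ^ C.scale X : ℕ) : ℝ) ^ 2) (m2 * ((L : ℝ) ^ C.scale X * eps L k) ^ 2) (Pi.single u 1) (yA X)))
            ⬝ᵥ ((effLaplacian (L ^ C.scale X) (fine L (M (C.scale X))) (aK a L (C.scale X))
                    (((L ^ C.scale X : ℕ) : ℝ) ^ 2) (m2 * ((L : ℝ) ^ C.scale X * eps L k) ^ 2)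
                  + (a * ((L : ℝ) ^ 2)⁻¹) • blockProj L (M (C.scale X)))⁻¹
                *ᵥ fun w => minimiser (L ^ C.scale X) (fine L (M (C.scale X))) (aK a L (C.scale X))
                    (((L ^ C.scale X : ℕ) : ℝ) ^ 2) (m2 * ((L : ℝ) ^ C.scale X * eps L k) ^ 2) (Pi.single w 1) (zA X)))
        (_hEB : ∀ g U X, EB g U X =
          (fun u => (holdist (L ^ n * L ^ C.scale X) (fine L (M (C.scale X))) (xB X) (yB X)) ^ (-α)
              * (minimiser (L ^ n * L ^ C.scale X) (fine L (M (C.scale X))) (aK a L (C.scale X + n))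
                    (((L ^ n * L ^ C.scale X : ℕ) : ℝ) ^ 2) (m2 * ((L : ℝ) ^ C.scale X * eps L k) ^ 2) (Pi.single u 1) (xB X)
                  - minimiser (L ^ n * L ^ C.scale X) (fine L (M (C.scale X))) (aK a L (C.scale X + n))
                    (((L ^ n * L ^ C.scale X : ℕ) : ℝ) ^ 2) (m2 * ((L : ℝ) ^ C.scale X * eps L k) ^ 2) (Pi.single u 1) (yB X)))
            ⬝ᵥ ((effLaplacian (L ^ n * L ^ C.scale X) (fine L (M (C.scale X))) (aK a L (C.scale X + n))
                    (((L ^ n * L ^ C.scale X : ℕ) : ℝ) ^ 2) (m2 * ((L : ℝ) ^ C.scale X * eps L k) ^ 2)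
                  + (a * ((L : ℝ) ^ 2)⁻¹) • blockProj L (M (C.scale X)))⁻¹
                *ᵥ fun w => minimiser (L ^ n * L ^ C.scale X) (fine L (M (C.scale X))) (aK a L (C.scale X + n))
                    (((L ^ n * L ^ C.scale X : ℕ) : ℝ) ^ 2) (m2 * ((L : ℝ) ^ C.scale X * eps L k) ^ 2) (Pi.single w 1) (zB X)))
        (W : Set (ℕ → ℝ)),
        NE5 EA EB W κ ((L : ℝ) ^ (-(γ / 2))) C₅ := by
  have hL1 : 1 ≤ L := by have := hLp.2; omega
  obtain ⟨κ, C₅, hκ, hC₅, H⟩ := ne5_kingModel_threeFactorHolder_torus_unif hd L hLp ha hm hα hγ hαγ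
  exact ⟨κ, C₅, hκ, hC₅, fun k n hn M _ hM C hsc hsk xA yA zA xB yB zB hx hy hz hdd EA EB hEA hEB W =>
    H n hn M hM C hsc xA yA zA xB yB zB hx hy hz hdd (fun X => m2 * ((L : ℝ) ^ C.scale X * eps L k) ^ 2)
      (fun X => physMass_pos hL1 hm _ _) (fun X => physMass_le_cap hL1 hm.le (hsk X)) EA EB hEA hEB W⟩

end Summit.QuantumFields.YangMills.BalabanUVNodes.N18KingModelTorusHolderMassUniform

end
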